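import Literature.MathematicalPhysics.QuantumFieldTheory.Balaban1983to89.B16Ineq17NearFlatDatumFamily
import Literature.MathematicalPhysics.QuantumFieldTheory.Balaban1983to89.Node00.MultiScaleFibreChartTwistB

/-!
# `Balaban1983to89.B16Ineq17NearFlatDatumFamilyB` — [Balaban1989LargeFieldI] (1.74) p. 192, (1.77) and Prop. 1 p. 194; [Balaban1989LargeFieldII] p. 359, (1.7) p. 358, (1.12)–(1.13) p. 359, (1.19) p. 360;
# [Balaban1988Convergent] (2.12) p. 256, (2.16) p. 257; [Balaban1984PropagatorsII] (= [II]) (2.3) p. 224: THE FAMILY-ON-FIBRE ∕ `haff` ∕ (β3) LETTERS FROM THE MINIMISER-FAMILY LETTER (K′) **OVER A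
# BOND-LEVEL DATUM** — the print-datum edition of the lane's `B16Ineq17NearFlatDatumFamily` §Record (all three of its datum-bearing declarations are used by N12's junction of record v14ᴸ),
# keyed on the lane's `Node00/MultiScaleFibreChartTwistB ∕ MultiScaleFibreChartB`

statement-level skeleton of published theorems with citation tags; proofs where landed; nothing here is a claim about
the Yang–Mills mass gap

Cell `pub-ymgap` (HUMAN RULINGS D-0062 ∕ D-0149), lane `pub-ymgap-dag-n12-c` g35 (R134 seat (a), N12 = [B15], s1, lane owner); `--kind proof --supports` K1⁹ `stmt-QuantumFields-27364`;
count-neutral.  THEOREMS ONLY (0 `def`, 0 `instance`, 0 `sorry`).  (E1) variant (iii-b), class (γ) of the lane's census-by-declaration (bus [DAGN12C-G35], 2026-08-30).  GENERATOR twin: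
`(𝐁 : DetSet) ↦ (𝔅 : BDetSet)`, `IsMinimizer ↦ IsMinimizerB`, `c ∈ bondsOf (𝐁 k) ↦ c ∈ 𝔅 k`, `ConstrSet ∕ constrCard ∕ constrEnum ∕ msChart ↦ …B`, the Twist lemmas ↦ their `…B` editions;
proofs VERBATIM; the parent's datum-free §PullBack (`exists_pullLie`, `qsstarG_expMul`) REUSED by name.  Same namespace as the parent, names with `isMinimizerB ∕ msChartB`.

HONESTY GUARD (director-ym №338 (5)).  PURELY ADDITIVE: the parent stays landed and true on its own text; nothing in it is edited; no displayed premise of any consumer is deleted or weakened.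
(K′) is a HYPOTHESIS; nothing of [15] ∕ [LF-II] asserted; count-neutral; N12 NOT discharged; K0⁷ ∕ K1⁹ NOT closed; one finite 𝕋⁴ programme at fixed ε — nothing continuum ∕ ℝ⁴ ∕ OS; the
Yang–Mills mass gap (Clay) is NOT proved by any of this.

WHAT IS HERE.  ★★★ `exists_twistFamily_of_isMinimizerB_family` · ★★★ `haff_msChartB_of_isMinimizerB_family` · ★★ `fderiv_msChartB_comp_apply_top_of_isMinimizerB_family`.

References: [Balaban1989LargeFieldI] (1.74) p.192, (1.77) and Prop. 1 p.194; [Balaban1989LargeFieldII] (1.7) p.358, p.359, (1.12)–(1.13) p.359, (1.19) p.360; [III] = [Balaban1988Convergent] (2.12) p.256,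
(2.16) p.257; [15] = [Balaban1985Variational] Sect. C (47)–(48) p.285, (82)–(83) p.290; [II] = [Balaban1984PropagatorsII] (2.3) p.224.
-/

noncomputable section

namespace Literature.MathematicalPhysics.QuantumFieldTheory.Balaban1983to89.B16Ineq17NearFlatDatumFamily

open Filter Topology
open T4Continuum BlockAveraging B16Sect1Backgrounds B15DeterminingSets B15DeterminingSetsB GaugeField
open Literature.MathematicalPhysics.QuantumFieldTheory.BalabanImbrieJaffe1984to88.BIJ85Eq453GaugeField

section RecordB

open T4CubeChartGnomonic (SU2)
open B15Prop1ChartSU2 (su2Chart su2Chart_iexp)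
open B15Prop1SliceCoordinates (GaugeSlice ιA)
open T4HaarSU2ExpChart (imQuat expPoint)
open T4AdjointCovarianceUnitary (lieSU expSU specialUnitaryAd)
open Literature.MathematicalPhysics.QuantumLattice (quatMatrix)
open Node00 (SU expChart msChartB ConstrSetB constrCardB constrEnumB avOfRecord)
open ExpMeanLog (expMeanLogSU)
open B16Ineq19FlatSliceChart (expPoint_eq_expSU)

variable {F : T4Family} {K k : ℕ} (S : Set (Site (F.P K) k)) (T : Finset (PBond (F.P K) k))
variable {φ : EuclideanSpace ℝ (Fin 3) →ₗ[ℝ] lieSU (Fin 2)}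

/-- ★★★ **THE FAMILY-ON-FIBRE LETTER (F) FROM THE MINIMISER-FAMILY LETTER (K′)** — no placement hypothesis.  If near `Y = 0` the configuration `expChart U₀ (X_f Y)` is a
minimal configuration for the datum `M˙(Q_k^{s*}(exp(i·ιA Y)·V))` on `𝐁` (dag-n12-c's (K′) shape; `𝐁`, `reg`, `V`, `U₀`, `X_f` arbitrary; `k ≤ m + K`), then there is a continuous
linear `Zf : B′ ↦ (Z(B′)_{(j,c)})_{(j,c) ∈ 𝐁}` into `𝔰𝔲(2)`-families — `Z(B′)_{(k,c)} = φ(ιA B′ c)` at the top scale, every component `0` or `φ(ιA B′ c̄)` — such that near `0`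
every constrained average of the family is the left translate `Ū^j(expChart U₀ (X_f Y))(c) = expSU(Z(Y)_{(j,c)})·M˙(Q_k^{s*}V)_j(c)`: the hypothesis `havg` of
`Node00.MultiScaleFibreChartTwist` (p606233) verbatim (`g₀ = 0`).  (`φ` = dag-n12-w3's `ℝ³ → 𝔰𝔲(2)` dictionary, `B16Ineq19FlatSliceChart.expPoint_eq_expSU`; `ιA` is made
continuous by the explicit bound `‖ιA B′ b‖ ≤ ‖B′‖`, `B15Prop1SliceCoordinates.norm_ιA_apply_le`.)
[cite: Balaban1989LargeFieldI, (1.74) p.192, (1.77) and Prop. 1 p.194; Balaban1989LargeFieldII, p.359, (1.19) p.360; Balaban1988Convergent, (2.12) p.256, (2.16) p.257] -/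
theorem exists_twistFamily_of_isMinimizerB_family (hk : k ≤ (F.P K).m + (F.P K).K)
    (hφ : ∀ v, ((φ v : lieSU (Fin 2)) : Matrix (Fin 2) (Fin 2) ℂ) = quatMatrix (imQuat v))
    (𝔅 : BDetSet (F.P K)) (reg : Set (GaugeField (F.P K) 0 (SU 2))) (V : GaugeField (F.P K) k (SU 2)) (U₀ : GaugeField (F.P K) 0 (SU 2))
    {Xf : GaugeSlice S T (EuclideanSpace ℝ (Fin 3)) → PBond (F.P K) 0 → lieSU (Fin 2)}
    (hmin : ∀ᶠ Y in 𝓝 (0 : GaugeSlice S T (EuclideanSpace ℝ (Fin 3))),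
      IsMinimizerB (avOfRecord F 2 K) reg 𝔅 (avgFamily (avOfRecord F 2 K) (qsstarGIter0 k (expMul su2Chart (ιA S T Y) V))) (expChart U₀ (Xf Y))) :
    ∃ Zf : GaugeSlice S T (EuclideanSpace ℝ (Fin 3)) →L[ℝ] (ConstrSetB 𝔅 k → lieSU (Fin 2)),
      (∀ Y (c : PBond (F.P K) k) (hc : c ∈ 𝔅 k), Zf Y ⟨Fin.last k, c, hc⟩ = φ (ιA S T Y c)) ∧
      (∀ s : ConstrSetB 𝔅 k, (∀ Y, Zf Y s = 0) ∨ ∃ c' : PBond (F.P K) k, ∀ Y, Zf Y s = φ (ιA S T Y c')) ∧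
      ∀ᶠ Y in 𝓝 (0 : GaugeSlice S T (EuclideanSpace ℝ (Fin 3))), ∀ s : ConstrSetB 𝔅 k,
        avgFamily (avOfRecord F 2 K) (expChart U₀ (Xf Y)) s.1 s.2.1
          = expSU (Zf (Y - 0) s) * avgFamily (avOfRecord F 2 K) (qsstarGIter0 k V) s.1 s.2.1 := by
  obtain ⟨ℓ, hℓtop, hℓshape, hℓ⟩ := exists_pullLie (P := F.P K) su2Chart (expMeanLogSU (n := Fin 2))
    (fun n => T3DescentFibreTower.expMeanLogSU_E_one (N := Fin 2) n) k hk
  -- `ιA` as a continuous linear map by an explicit bound (the `PiLp` slice wants `mkContinuous`, not `toContinuousLinearMap`)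
  let ιAL : GaugeSlice S T (EuclideanSpace ℝ (Fin 3)) →L[ℝ] VecField (F.P K) k (EuclideanSpace ℝ (Fin 3)) :=
    (ιA S T).mkContinuous 1 fun B => by
      rw [one_mul]
      exact (pi_norm_le_iff_of_nonneg (norm_nonneg B)).2 fun b => B15Prop1SliceCoordinates.norm_ιA_apply_le B b
  let Zf : GaugeSlice S T (EuclideanSpace ℝ (Fin 3)) →L[ℝ] (ConstrSetB 𝔅 k → lieSU (Fin 2)) :=
    ContinuousLinearMap.pi fun s : ConstrSetB 𝔅 k => (LinearMap.toContinuousLinearMap (φ ∘ₗ ℓ (s.1 : ℕ) s.2.1)).comp ιAL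
  have hZf : ∀ Y s, Zf Y s = φ (ℓ (s.1 : ℕ) s.2.1 (ιA S T Y)) := fun _ _ => rfl
  refine ⟨Zf, ?_, ?_, ?_⟩
  · intro Y c hc
    rw [hZf]
    show φ (ℓ k c (ιA S T Y)) = _
    rw [hℓtop]
    rfl
  · intro s
    rcases hℓshape (s.1 : ℕ) s.2.1 with h0 | ⟨c', hc'⟩
    · left
      intro Y
      rw [hZf, h0, LinearMap.zero_apply, map_zero]
    · right
      refine ⟨c', fun Y => ?_⟩
      rw [hZf, hc']
      rfl
  · filter_upwards [hmin] with Y hY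
    intro s
    have hj : (s.1 : ℕ) ≤ k := Nat.lt_succ_iff.mp s.1.isLt
    rw [sub_zero, hY.2.1 (s.1 : ℕ) s.2.1 s.2.2]
    show Averaging.iter (fun i : ℕ => (blockAvg expMeanLogSU : Averaging (F.P K) i (SU 2))) (s.1 : ℕ)
        (qsstarGIter0 k (expMul su2Chart (ιA S T Y) V)) s.2.1
      = expSU (Zf Y s) * Averaging.iter (fun i : ℕ => (blockAvg expMeanLogSU : Averaging (F.P K) i (SU 2))) (s.1 : ℕ) (qsstarGIter0 k V) s.2.1
    rw [hℓ (ιA S T Y) V (s.1 : ℕ) hj s.2.1, hZf, su2Chart_iexp, expPoint_eq_expSU hφ]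


/-- ★★★ **THE SKELETON'S `haff` AT THE RECORD FROM (K′) ALONE**: under the minimiser-family letter, for EVERY functional `λ₀` and all directions,
`λ₀ (D²(msChartB F 2 K k 𝐁 (M˙(Q_k^{s*}V)) U₀ ∘ X_f)(0)[h,h′]) = 0` — the binder `haff` of `B16Ineq17NearFlatWilsonLetters.hessian_wilsonAction4_criticalExpChartFamily_ge_flatMin_sub` ∕
`B15Prop1SliceHessianOfChartFamily.h17Shape_sliceFn_of_nearFlatCriticalExpChartFamily` at the chart of record (`Node00.haff_msChartB_of_avg_family` ∘ §2).
[cite: Balaban1989LargeFieldII, (1.7) p.358, (1.12)–(1.13) p.359; Balaban1985Variational, Sect. C (47)–(48) p.285, (82)–(83) p.290] -/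
theorem haff_msChartB_of_isMinimizerB_family (hk : k ≤ (F.P K).m + (F.P K).K)
    (hφ : ∀ v, ((φ v : lieSU (Fin 2)) : Matrix (Fin 2) (Fin 2) ℂ) = quatMatrix (imQuat v))
    (𝔅 : BDetSet (F.P K)) (reg : Set (GaugeField (F.P K) 0 (SU 2))) (V : GaugeField (F.P K) k (SU 2)) (U₀ : GaugeField (F.P K) 0 (SU 2))
    {Xf : GaugeSlice S T (EuclideanSpace ℝ (Fin 3)) → PBond (F.P K) 0 → lieSU (Fin 2)}
    (hmin : ∀ᶠ Y in 𝓝 (0 : GaugeSlice S T (EuclideanSpace ℝ (Fin 3))),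
      IsMinimizerB (avOfRecord F 2 K) reg 𝔅 (avgFamily (avOfRecord F 2 K) (qsstarGIter0 k (expMul su2Chart (ιA S T Y) V))) (expChart U₀ (Xf Y)))
    (lam : (Fin (constrCardB 𝔅 k) → lieSU (Fin 2)) →L[ℝ] ℝ) (h h' : GaugeSlice S T (EuclideanSpace ℝ (Fin 3))) :
    lam (fderiv ℝ (fun g => fderiv ℝ (fun g => msChartB F 2 K k 𝔅 (avgFamily (avOfRecord F 2 K) (qsstarGIter0 k V)) U₀ (Xf g)) g) 0 h h') = 0 := by
  obtain ⟨Zf, -, -, havg⟩ := exists_twistFamily_of_isMinimizerB_family S T hk hφ 𝔅 reg V U₀ hmin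
  exact Node00.haff_msChartB_of_avg_family Zf havg lam h h'

/-- ★★ **(β3) THE TWISTED DATUM VELOCITY AT THE RECORD**: under (K′), with `X_f` differentiable at `0` (derivative `X_f′`) and the chart differentiable at `X_f 0`, the top-scale
component of `D(msChartB …)(X_f 0)(X_f′ h)` at the constrained bond `(k,c)` is `Ad_{W_k(c)⁻¹} φ(ιA h c)`, `W = M˙(Q_k^{s*}V)` — the `y` of the Federbush fibre letter `hm`∕`hy`, twisted
as located (R2) (`Node00.fderiv_msChartB_comp_apply_eq_ad` ∘ §2). [cite: Balaban1989LargeFieldII, (1.12) p.359, (1.19) p.360; Balaban1985Variational, (82)–(83) p.290] -/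
theorem fderiv_msChartB_comp_apply_top_of_isMinimizerB_family (hk : k ≤ (F.P K).m + (F.P K).K)
    (hφ : ∀ v, ((φ v : lieSU (Fin 2)) : Matrix (Fin 2) (Fin 2) ℂ) = quatMatrix (imQuat v))
    (𝔅 : BDetSet (F.P K)) (reg : Set (GaugeField (F.P K) 0 (SU 2))) (V : GaugeField (F.P K) k (SU 2)) (U₀ : GaugeField (F.P K) 0 (SU 2))
    {Xf : GaugeSlice S T (EuclideanSpace ℝ (Fin 3)) → PBond (F.P K) 0 → lieSU (Fin 2)}
    (hmin : ∀ᶠ Y in 𝓝 (0 : GaugeSlice S T (EuclideanSpace ℝ (Fin 3))),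
      IsMinimizerB (avOfRecord F 2 K) reg 𝔅 (avgFamily (avOfRecord F 2 K) (qsstarGIter0 k (expMul su2Chart (ιA S T Y) V))) (expChart U₀ (Xf Y)))
    {X' : GaugeSlice S T (EuclideanSpace ℝ (Fin 3)) →L[ℝ] PBond (F.P K) 0 → lieSU (Fin 2)} (hX : HasFDerivAt Xf X' 0)
    (hΨ : DifferentiableAt ℝ (msChartB F 2 K k 𝔅 (avgFamily (avOfRecord F 2 K) (qsstarGIter0 k V)) U₀) (Xf 0))
    (h : GaugeSlice S T (EuclideanSpace ℝ (Fin 3))) (c : PBond (F.P K) k) (hc : c ∈ 𝔅 k) :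
    fderiv ℝ (msChartB F 2 K k 𝔅 (avgFamily (avOfRecord F 2 K) (qsstarGIter0 k V)) U₀) (Xf 0) (X' h) (constrEnumB 𝔅 k ⟨Fin.last k, c, hc⟩)
      = specialUnitaryAd (avgFamily (avOfRecord F 2 K) (qsstarGIter0 k V) k c)⁻¹ (φ (ιA S T h c)) := by
  obtain ⟨Zf, htop, -, havg⟩ := exists_twistFamily_of_isMinimizerB_family S T hk hφ 𝔅 reg V U₀ hmin
  rw [Node00.fderiv_msChartB_comp_apply_eq_ad Zf havg hX hΨ h]
  have hgen : ∀ x : ConstrSetB 𝔅 k, x = ⟨Fin.last k, c, hc⟩ →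
      specialUnitaryAd (avgFamily (avOfRecord F 2 K) (qsstarGIter0 k V) x.1 x.2.1)⁻¹ (Zf h x)
        = specialUnitaryAd (avgFamily (avOfRecord F 2 K) (qsstarGIter0 k V) k c)⁻¹ (φ (ιA S T h c)) := by
    rintro x rfl
    rw [htop]
    rfl
  exact hgen _ ((constrEnumB 𝔅 k).symm_apply_apply _)


end RecordB

end Literature.MathematicalPhysics.QuantumFieldTheory.Balaban1983to89.B16Ineq17NearFlatDatumFamily

end
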